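import Literature.Algebra.EuclideanLattices.RegevRoutineParse
import Literature.Algebra.EuclideanLattices.RegevCandidateSelection
import Literature.Algebra.EuclideanLattices.RegevPointSetUnrankFP
import Literature.Computability.Complexity.CanonicalCodes
import Literature.Computability.FineGrained.SATBruteForceCount
import HarnessLib

/-!
# Regev's per-copy routine as a circuit family, IX: the block functions (mathematical content)

Ninth file of the circuit-level construction towards the discharge of
`Literature.Algebra.EuclideanLattices.usvp_of_dihedralCoset` (O. Regev, *Quantum computation and
lattice problems*, SIAM J. Comput. 33 (2004), Thm. 1.1). The two garbage-free blocks of the routine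
(proof of Lemma 3.12, p. 14: "we add the value `f(t, ā)` to the last register … we measure the
last register") are "parse (file VIII), then compute"; this file defines WHAT they compute, as
total functions of the parsed data, and proves the one identity the routine relies on (the
semantic interface `SemHyp.hv` of file V: the second block returns the `ix` coins and the erase
mask of `ta`). Polynomial-time realisations and the parameter set follow in the sequels.

* `Payload`, `ePayload`, `dPayload`, `cPayload` (`cPayload_eq`, `cPayload_mem_FP`),
  `payloadOf` — the instance record carried by the routine's input string `x = ⟨code, padding⟩`:
  the rows of the (reduced, scaled) basis, the modulus `p`, the number of levels `Q` of the
  quantised ball and the table of cell sizes `Δ` indexed by the radius guess; read through the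
  TOTAL decoder of its code, so that the blocks are specified on every string;
* `Guess`, `readGuess` (field widths `widths`), `radius`, `numIdx` (`κ`), `Live`/`live` — the
  guesses read off the guess zone and the liveness test of a register;
* `ctrlBit`, `digitsOf`, `coeffsOf`, `pointOf`, `valueOf` — `t`, `ā`, Regev's coefficient vector
  of `f(t, ā)` (`twoPointCoeffs`), the grid point `x̄ = unrank idx` and the measured value
  `F = f(t, ā) + x̄`;
* `WOut`, `wOut`, `wOutE` — the first block's output: `(F, u_rest, ε, ε)` for a live register,
  `(ε, ε, ix, ta)` for a dead one, written as the code `⟨⟨F, ⟨u_rest, ⟨ix, ta⟩⟩⟩, ε⟩`;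
  `vOut` — the second block's output: the `min κ kap`-bit expansion of `rank (F − f(t, ā))` followed by
  `u_rest` and the empty mask (live), `ix` followed by `ta` (dead);
* **`vOut_wOut`** — `vOut … (wOut … ix ta …) = ix ++ (live ? 0^{sig} : ta)`: unranking then
  ranking the grid point gives back the index coins (`Regev2004.rank_unrank`, `lowBits_bitsToNat`).

No named fact is introduced.

## References

* O. Regev, *Quantum computation and lattice problems*, SIAM J. Comput. 33 (2004) 738–760, proof
  of Lemma 3.12 (p. 14), proof of Lemma 3.4 (p. 8: the function `f`), proof of Thm. 1.1 (p. 7: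
  the guesses) [Regev2004].
* C. H. Bennett, *Logical reversibility of computation*, IBM J. Res. Develop. 17 (1973), §2
  [Bennett1973].
-/

noncomputable section

namespace Literature.Algebra.EuclideanLattices

namespace RegevRoutine

open _root_.Computability Literature.Computability.Complexity Literature.Computability.Complexity.Brick
  Literature.Computability.Complexity.CanonCode Literature.Computability.Complexity.CodeFP Regev2004
open Literature.Computability.FineGrained.BruteForce (bitsToNat_injective_of_length_eq)

/-! ### The payload and its total decoder -/

/-- **The payload**: rows of the basis, the modulus `p`, the number of levels `Q`, the table of
cell sizes `Δ` by radius guess. [cite: Regev2004, Lemma 3.12 (proof, p. 14: the reduced basis, p, and the radius R)] -/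
abbrev Payload : Type := List (List ℤ) × (ℕ × (ℕ × List ℕ))

namespace Payload

/-- The rows of the basis. [folklore] -/
abbrev rows (pl : Payload) : List (List ℤ) := pl.1
/-- The modulus `p`. [folklore] -/
abbrev modP (pl : Payload) : ℕ := pl.2.1
/-- The number of levels `Q`. [folklore] -/
abbrev levels (pl : Payload) : ℕ := pl.2.2.1
/-- The table of cell sizes. [folklore] -/
abbrev radii (pl : Payload) : List ℕ := pl.2.2.2

end Payload

/-- The Boolean encoding of payloads (lists with unary headers, sign–magnitude integers, binary
naturals). [folklore] -/
def ePayload : Encoding Payload Bool :=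
  (encodingIntBool.listBool.listBool).pairBool (encodingNatBool.pairBool (encodingNatBool.pairBool encodingNatBool.listBool))

/-- Total decoder of a row. [folklore] -/
def dRow (w : List Bool) : List ℤ := NegCNF.decList decInt (boolUnpair w).1.length (boolUnpair w).2
/-- Total decoder of the rows. [folklore] -/
def dRows (w : List Bool) : List (List ℤ) := NegCNF.decList dRow (boolUnpair w).1.length (boolUnpair w).2
/-- Total decoder of a list of naturals. [folklore] -/
def dNats (w : List Bool) : List ℕ := NegCNF.decList decodeNat (boolUnpair w).1.length (boolUnpair w).2

/-- **The total decoder of payloads.** [folklore] -/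
def dPayload (w : List Bool) : Payload :=
  (dRows (boolUnpair w).1, (decodeNat (boolUnpair (boolUnpair w).2).1,
    (decodeNat (boolUnpair (boolUnpair (boolUnpair w).2).2).1, dNats (boolUnpair (boolUnpair (boolUnpair w).2).2).2)))

/-- Canonicaliser of a row code. [folklore] -/
def cRow : List Bool → List Bool := canonListFnC 6 canonIntFn
/-- Canonicaliser of the rows code. [folklore] -/
def cRows : List Bool → List Bool := canonListFnC 10 cRow
/-- Canonicaliser of a list-of-naturals code. [folklore] -/
def cNats : List Bool → List Bool := canonListFnC 2 canonF

/-- **The canonicaliser of payload codes**: `encode ∘ decode`. [folklore] -/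
def cPayload : List Bool → List Bool := canonPairFn cRows (canonPairFn canonF (canonPairFn canonF cNats))

/-- `cRow` re-encodes. [folklore] -/
theorem cRow_eq (w : List Bool) : encodingIntBool.listBool.decode w = some (dRow w) ∧ cRow w = encodingIntBool.listBool.encode (dRow w) :=
  canonListFnC_eq encodingIntBool decInt decode_int canonIntFn_eq (A := 1) (B := 5) (fun u => by have := length_canonIntFn_le u; omega) (by norm_num) w

/-- Size of `cRow`. [folklore] -/
theorem length_cRow_le (w : List Bool) : (cRow w).length ≤ 8 * w.length + 2 :=
  length_canonListFnC_le (A := 1) (B := 5) (fun u => by have := length_canonIntFn_le u; omega) (by norm_num) w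

/-- `cRows` re-encodes. [folklore] -/
theorem cRows_eq (w : List Bool) :
    encodingIntBool.listBool.listBool.decode w = some (dRows w) ∧ cRows w = encodingIntBool.listBool.listBool.encode (dRows w) :=
  canonListFnC_eq encodingIntBool.listBool dRow (fun u => (cRow_eq u).1) (fun u => (cRow_eq u).2) (A := 8) (B := 2) length_cRow_le (by norm_num) w

/-- `cNats` re-encodes. [folklore] -/
theorem cNats_eq (w : List Bool) : encodingNatBool.listBool.decode w = some (dNats w) ∧ cNats w = encodingNatBool.listBool.encode (dNats w) :=
  canonListFnC_eq encodingNatBool decodeNat (fun _ => rfl) canonF_eq_encodeNat_decodeNat (A := 1) (B := 1)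
    (fun u => by have := length_canonF_le u; omega) (by norm_num) w

/-- **`cPayload` re-encodes**: `cPayload w = encode (dPayload w)`. [folklore] -/
theorem cPayload_eq (w : List Bool) : cPayload w = ePayload.encode (dPayload w) := by
  have h3 := fun u => canonPairFn_eq encodingNatBool encodingNatBool.listBool decodeNat dNats (fun _ => rfl) (fun u => (cNats_eq u).1)
    (ca := canonF) (cb := cNats) canonF_eq_encodeNat_decodeNat (fun u => (cNats_eq u).2) u
  have h2 := fun u => canonPairFn_eq encodingNatBool _ decodeNat _ (fun _ => rfl) (fun u => (h3 u).1)
    (ca := canonF) (cb := canonPairFn canonF cNats) canonF_eq_encodeNat_decodeNat (fun u => (h3 u).2) u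
  have h1 := canonPairFn_eq encodingIntBool.listBool.listBool _ dRows _ (fun u => (cRows_eq u).1) (fun u => (h2 u).1)
    (ca := cRows) (cb := canonPairFn canonF (canonPairFn canonF cNats)) (fun u => (cRows_eq u).2) (fun u => (h2 u).2) w
  exact h1.2

/-- `cPayload ∈ FP`. [cite: AroraBarak2009, §1.3] -/
theorem cPayload_mem_FP : cPayload ∈ FP :=
  canonPairFn_mem_FP (canonListFnC_mem_FP _ (canonListFnC_mem_FP _ canonIntFn_mem_FP))
    (canonPairFn_mem_FP canonF_mem_FP (canonPairFn_mem_FP canonF_mem_FP (canonListFnC_mem_FP _ canonF_mem_FP)))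

/-- Decoding a genuine payload code. [folklore] -/
theorem dPayload_encode (pl : Payload) : dPayload (ePayload.encode pl) = pl := by
  have h3 := fun u => canonPairFn_eq encodingNatBool encodingNatBool.listBool decodeNat dNats (fun _ => rfl) (fun u => (cNats_eq u).1)
    (ca := canonF) (cb := cNats) canonF_eq_encodeNat_decodeNat (fun u => (cNats_eq u).2) u
  have h2 := fun u => canonPairFn_eq encodingNatBool _ decodeNat _ (fun _ => rfl) (fun u => (h3 u).1)
    (ca := canonF) (cb := canonPairFn canonF cNats) canonF_eq_encodeNat_decodeNat (fun u => (h3 u).2) u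
  have h1 := canonPairFn_eq encodingIntBool.listBool.listBool _ dRows _ (fun u => (cRows_eq u).1) (fun u => (h2 u).1)
    (ca := cRows) (cb := canonPairFn canonF (canonPairFn canonF cNats)) (fun u => (cRows_eq u).2) (fun u => (h2 u).2) (ePayload.encode pl)
  have hd : ePayload.decode (ePayload.encode pl) = some (dPayload (ePayload.encode pl)) := h1.1
  rw [ePayload.decode_encode] at hd
  exact (Option.some.inj hd).symm

/-- **The payload of an input string**: decode the first component. [folklore] -/
def payloadOf (xs : List Bool) : Payload := dPayload (fstF xs)

/-- The payload of a genuine input `⟨code, padding⟩`. [folklore] -/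
theorem payloadOf_input (pl : Payload) (pad : List Bool) : payloadOf (boolPair (ePayload.encode pl) pad) = pl := by
  rw [payloadOf, fstF_boolPair, dPayload_encode]

/-! ### The guesses -/

/-- The guesses: radius index `ρ`, residue `m`, coordinate `i₀`, register count `r'`. [cite: Regev2004, Thm. 1.1 (proof, p. 7: the values l, m, i₀) and Lemma 3.12 (the number of registers)] -/
structure Guess where
  /-- index of the radius guess -/
  rho : ℕ
  /-- the residue `m` -/
  m : ℕ
  /-- the coordinate `i₀` -/
  i0 : ℕ
  /-- the register count `r'` -/
  r' : ℕ
  deriving DecidableEq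

/-- The widths of the four guess fields (bit lengths of their ranges). [folklore] -/
def widths (S : Sizes) (L : ℕ) (pl : Payload) : ℕ × (ℕ × (ℕ × ℕ)) :=
  (Nat.size pl.radii.length, (Nat.size pl.modP, (Nat.size (nOf L), Nat.size (S.pr.eval (ell L) + 1))))

/-- **Reading the guesses off the guess zone** (four little-endian fields of the widths `widths`). [cite: Regev2004, Thm. 1.1 (proof, p. 7)] -/
def readGuess (S : Sizes) (L : ℕ) (pl : Payload) (g : List Bool) : Guess :=
  ⟨bitsToNat (g.take (widths S L pl).1),
    bitsToNat ((g.drop (widths S L pl).1).take (widths S L pl).2.1),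
    bitsToNat ((g.drop ((widths S L pl).1 + (widths S L pl).2.1)).take (widths S L pl).2.2.1),
    bitsToNat ((g.drop ((widths S L pl).1 + (widths S L pl).2.1 + (widths S L pl).2.2.1)).take (widths S L pl).2.2.2)⟩

/-- The cell size `Δ ≥ 1` of the quantised ball for the radius guess. [cite: Regev2004, Lemma 3.12 (proof, p. 14: R = c_bal n^{1/2+2f} l)] -/
def radius (pl : Payload) (G : Guess) : ℕ := max 1 (pl.radii.getD G.rho 0)

/-- `1 ≤ Δ`. [folklore] -/
theorem radius_pos (pl : Payload) (G : Guess) : 0 < radius pl G := by unfold radius; omega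

/-- The number of levels actually used: `Q` capped by the input length (the cap is inactive on
genuine inputs, whose length exceeds `Q`; it keeps the unary budget of the blocks polynomial). [folklore] -/
def qLevels (L : ℕ) (pl : Payload) : ℕ := min pl.levels L

/-- The number `κ` of index coins: `⌊log₂ |quantised ball|⌋`. [cite: Regev2004, Lemma 3.11 (exact variant: 2^κ grid points)] -/
def numIdx (L : ℕ) (pl : Payload) (G : Guess) : ℕ := Nat.log 2 (qCount (radius pl G) (nOf L) (qLevels L pl))

/-- `κ` is the `kappa` of the quantised ball. [folklore] -/
theorem numIdx_eq_kappa (L : ℕ) (pl : Payload) (G : Guess) : numIdx L pl G = Regev2004.kappa (nOf L) (qLevels L pl) (radius pl G) := by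
  rw [numIdx, kappa_eq_log_qCount (radius_pos pl G)]

/-- **The low `K` bits of `r`**, little-endian, as a string of length `K` (for `r < 2^K` the binary
expansion of `r` padded with zeros). [folklore] -/
def lowBits (K r : ℕ) : List Bool := (encodeNat r ++ List.replicate K false).take K

/-- **The low bits of the value of a string of length `K` are the string.** [folklore] -/
theorem lowBits_bitsToNat (l : List Bool) : lowBits l.length (bitsToNat l) = l := by
  unfold lowBits
  have hlen : (encodeNat (bitsToNat l)).length ≤ l.length := by
    rw [TM2Pass.length_encodeNat_eq_size, Nat.size_le]; exact bitsToNat_lt l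
  apply bitsToNat_injective_of_length_eq
  · simp
  · rw [List.take_append, List.take_of_length_le hlen, List.take_replicate, bitsToNat_append, bitsToNat_encodeNat,
      bitsToNat_replicate_false, mul_zero, add_zero]

/-- **Liveness of register `k`**: below the guessed register count, and the guesses and the
instance are sane. [cite: Regev2004, Lemma 3.12 (proof, p. 14: r registers are prepared)] -/
def Live (S : Sizes) (L : ℕ) (pl : Payload) (G : Guess) (k : ℕ) : Prop :=
  k < G.r' ∧ numIdx L pl G ≤ S.pkap.eval L ∧ G.i0 < nOf L ∧ 0 < G.m ∧ G.m < pl.modP ∧ G.rho < pl.radii.length ∧ 1 ≤ nOf L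

/-- Liveness is decidable. [folklore] -/
instance instDecidableLive (S : Sizes) (L : ℕ) (pl : Payload) (G : Guess) (k : ℕ) : Decidable (Live S L pl G k) := by
  unfold Live; infer_instance

/-! ### The zone data and the measured value -/

/-- The control bit `t` (first bit of `ta`). [cite: Regev2004, Lemma 3.12 (proof, p. 14: t ∈ {0,1})] -/
def ctrlBit (ta : List Bool) : Bool := ta.headD false

/-- The digits `ā`: `n` fields of `4n` bits after the control bit, each followed by a separator. [cite: Regev2004, Lemma 3.12 (proof, p. 14: ā ∈ {0,…,M−1}ⁿ, M = 2^{4n})] -/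
def digitsOf (n : ℕ) (ta : List Bool) : List ℕ :=
  (List.range n).map fun i => bitsToNat (((ta.drop 1).drop (i * (4 * n + 1))).take (4 * n))

/-- **Regev's coefficient vector of `f(t, ā)`**: `ā` with `a_{i₀}` replaced by `a_{i₀} p + t m`. [cite: Regev2004, Lemma 3.4 (proof, p. 8: f(t,ā) = (a₁p + tm) b̄₁ + ∑ aᵢ b̄ᵢ)] -/
def coeffsOf (p m i0 : ℕ) (t : Bool) (a : List ℕ) : List ℤ :=
  (a.map (Nat.cast : ℕ → ℤ)).set i0 ((a.getD i0 0 : ℤ) * p + (if t then (m : ℤ) else 0))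

/-- **The grid point `x̄`** of the index coins: the `idx`-th point of the quantised ball. [cite: Regev2004, Lemma 3.12 (proof, p. 14: x̄ ∈ ℤⁿ/L ∩ Bₙ) and Lemma 3.11 (exact variant)] -/
def pointOf (L : ℕ) (pl : Payload) (G : Guess) (ix : List Bool) : List ℤ :=
  List.ofFn (unrank (radius pl G) (nOf L) (qLevels L pl) (bitsToNat (ix.take (numIdx L pl G))))

/-- The lattice point `f(t, ā)` as a list. [cite: Regev2004, Lemma 3.4 (proof, p. 8)] -/
def latticeOf (L : ℕ) (pl : Payload) (G : Guess) (ta : List Bool) : List ℤ :=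
  vecMulL (nOf L) (coeffsOf pl.modP G.m G.i0 (ctrlBit ta) (digitsOf (nOf L) ta)) pl.rows

/-- **The measured value `F = f(t, ā) + x̄`.** [cite: Regev2004, Lemma 3.12 (proof, p. 14: "we add the value f(t, ā) to the last register")] -/
def valueOf (L : ℕ) (pl : Payload) (G : Guess) (ix ta : List Bool) : List ℤ :=
  List.zipWith (· + ·) (latticeOf L pl G ta) (pointOf L pl G ix)

/-! ### The outputs of the two blocks -/

/-- The type of the first block's output: `(F, (u_rest, (ix, ta)))`. [folklore] -/
abbrev WOut : Type := List ℤ × (List Bool × (List Bool × List Bool))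

/-- **The first block's output**: `(F, u_rest, ε, ε)` for a live register (the data the analysis
conditions on), `(ε, ε, ix, ta)` for a dead one (an injective copy). [cite: Regev2004, Lemma 3.12 (proof, p. 14: the measured register)] -/
def wOut (S : Sizes) (L : ℕ) (xs g ix ta : List Bool) (k : ℕ) : WOut :=
  if Live S L (payloadOf xs) (readGuess S L (payloadOf xs) g) k then
    (valueOf L (payloadOf xs) (readGuess S L (payloadOf xs) g) ix ta, (ix.drop (numIdx L (payloadOf xs) (readGuess S L (payloadOf xs) g)), ([], [])))
  else ([], ([], (ix, ta)))

/-- The code of the first block's output (self-delimiting from the left: the result wires are read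
back up to the first empty cell). [folklore] -/
def wOutE : WOut → List Bool := fun o => boolPair (pairE (listE smE) (pairE strE (pairE strE strE)) o) []

/-- `wOutE` is injective. [folklore] -/
theorem wOutE_injective : Function.Injective wOutE := fun a b h => by
  have h1 := congrArg fstF h
  simp only [wOutE, fstF_boolPair] at h1
  exact pairE_injective (listE_injective smE_injective) (pairE_injective (fun _ _ h => h) (pairE_injective (fun _ _ h => h) (fun _ _ h => h))) h1

/-- **The second block's output** on the first block's output `o`: the `κ`-bit expansion of
`rank (F − f(t, ā))`, then `u_rest`, then the empty erase mask (live); `ix` then `ta` (dead).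
[cite: Bennett1973, §2 (recompute what is to be erased from the kept data and the result)] -/
def vOut (S : Sizes) (L : ℕ) (xs g ta : List Bool) (k : ℕ) (o : WOut) : List Bool :=
  if Live S L (payloadOf xs) (readGuess S L (payloadOf xs) g) k then
    lowBits (min (numIdx L (payloadOf xs) (readGuess S L (payloadOf xs) g)) (S.pkap.eval L))
        (rank (radius (payloadOf xs) (readGuess S L (payloadOf xs) g)) (nOf L) (qLevels L (payloadOf xs))
          fun j => (List.zipWith (· - ·) o.1 (latticeOf L (payloadOf xs) (readGuess S L (payloadOf xs) g) ta)).getD j 0) ++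
      (o.2.1 ++ List.replicate (sig L) false)
  else o.2.2.1 ++ o.2.2.2

/-! ### The semantic identity: the second block returns the index coins and the erase mask -/

/-- `latticeOf` has length `n`. [folklore] -/
theorem length_latticeOf (L : ℕ) (pl : Payload) (G : Guess) (ta : List Bool) : (latticeOf L pl G ta).length = nOf L :=
  length_vecMulL _ _ _

/-- `(v + x̄) − v = x̄`, termwise on lists of length `n`. [folklore] -/
theorem zipWith_sub_zipWith_add (v x : List ℤ) (h : v.length = x.length) :
    List.zipWith (· - ·) (List.zipWith (· + ·) v x) v = x := by
  induction v generalizing x with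
  | nil => cases x <;> simp_all
  | cons a v ih =>
    cases x with
    | nil => simp at h
    | cons b x => simp only [List.zipWith_cons_cons, add_sub_cancel_left, List.cons.injEq, true_and]; exact ih x (by simpa using h)

/-- **The semantic identity.** With `ix` of length `kap`: on the first block's output the second
block returns `ix` followed by the erase mask — empty for a live register, `ta` for a dead one.
[cite: Bennett1973, §2] -/
theorem vOut_wOut (S : Sizes) (L : ℕ) (xs g ix ta : List Bool) (k : ℕ) (hix : ix.length = S.pkap.eval L) :
    vOut S L xs g ta k (wOut S L xs g ix ta k) =
      ix ++ (if Live S L (payloadOf xs) (readGuess S L (payloadOf xs) g) k then List.replicate (sig L) false else ta) := by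
  unfold vOut wOut
  by_cases hl : Live S L (payloadOf xs) (readGuess S L (payloadOf xs) g) k
  · rw [if_pos hl, if_pos hl, if_pos hl]
    dsimp only
    set pl := payloadOf xs
    set G := readGuess S L pl g
    have hκ : numIdx L pl G ≤ ix.length := by rw [hix]; exact hl.2.1
    have hsub : List.zipWith (· - ·) (valueOf L pl G ix ta) (latticeOf L pl G ta) = pointOf L pl G ix := by
      unfold valueOf
      exact zipWith_sub_zipWith_add _ _ (by rw [length_latticeOf, pointOf, List.length_ofFn])
    rw [hsub]
    have hfun : (fun j : Fin (nOf L) => (pointOf L pl G ix).getD j 0) =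
        unrank (radius pl G) (nOf L) (qLevels L pl) (bitsToNat (ix.take (numIdx L pl G))) := by
      funext j; rw [pointOf, Regev2004.getD_ofFn]
    rw [hfun, rank_unrank (radius_pos pl G), min_eq_left hl.2.1]
    · have e2 := lowBits_bitsToNat (ix.take (numIdx L pl G))
      rw [List.length_take, min_eq_left hκ] at e2
      rw [e2, ← List.append_assoc, List.take_append_drop]
    · -- `idx < 2^κ ≤ |qBall|`
      calc bitsToNat (ix.take (numIdx L pl G)) < 2 ^ (ix.take (numIdx L pl G)).length := bitsToNat_lt _
        _ = 2 ^ numIdx L pl G := by rw [List.length_take]; congr 1; omega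
        _ ≤ (qBall (nOf L) (qLevels L pl) (radius pl G)).card := by rw [numIdx_eq_kappa]; exact two_pow_kappa_le _ _ _ (radius_pos pl G)
  · rw [if_neg hl, if_neg hl, if_neg hl]

end RegevRoutine

end Literature.Algebra.EuclideanLattices

end
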